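import Mathlib
import Literature.Geometry.Riemannian.SphericalCylinderEntropy
import Literature.Geometry.Riemannian.ColdingMinicozziEntropyValues
import Literature.Geometry.Riemannian.MeanConvexLevelSetFlow
import Literature.Topology.FourManifolds.NeckCapping
import Literature.Topology.FourManifolds.ClosedBall
import HarnessLib

/-!
# Route `CylinderEntropy`, crux `CylinderRungTwo` (stmt-SmoothPoincare4-7631):
# vocabulary of the line `proxy-models-below-bubble-sheet`

Route-posited objects (D-0016 `<Route>Defs` file) shared by the registered stubs of the skeleton
`Cruxes/CylinderRungTwo/Lines/proxy-models-below-bubble-sheet.lean` (definition requests D1–D4 of its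
line card) and by the crux file that composes them. Everything here is a plain `Set`, a `Prop`-valued
predicate over existing tree declarations (`Literature.Geometry.Riemannian.levelSetFlow` — White's biggest
weak set flow —, `Literature.Geometry.Lorentzian.PseudoRiemannianMetric`, `gaussianEntropy`,
`shrinkingCylinder`, `Literature.Topology.FourManifolds.NeckCapData`), or an inductive predicate; nothing
is asserted.

* `cylN` — the round cylinder `N = S⁴ × ℝ = {z ∈ ℝ⁶ | ∑_{i<5} zᵢ² = 1}`, spelled as in the route items;
  `SeparatesEnds A` — the items' typed `JoinedIn` end-separation predicate, verbatim.
* D1 `IsCylinderPresentation gN emb` — `(Ncar, gN, emb)` presents `N` as an abstract Riemannian 5-manifold: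
  `emb : Ncar → ℝ⁶` a `C^∞` embedding onto `cylN` pulling the Euclidean inner product back to `gN`.
* D2 `flowTrack gN emb K₀` (spacetime track in `ℝ⁶ × ℝ` of the level set flow of `K₀` in `N`), `dilate`,
  `shrinkerTrack`, `window`, `IsBlowUpModel` (set-level backward blow-up models: local Hausdorff
  convergence of parabolic dilations on the windows `B̄_R × [-R, -1/R]` along a sequence of scales).
* D3 `IsTameModel` (hyperplane / `S³(√6) × ℝ` / compact smooth connected hypersurface, placed in `T_{x₀}N`
  by a linear isometry), `IsTamePoint`, `IsTame`, `HasThinTrack` (non-fattening), `ModelEntropyBound`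
  (Hamilton's bound in Chodosh–Mantoulidis–Schulze currency: compact smooth models have
  `gaussianEntropy 4 < gaussianEntropy 4 (shrinkingCylinder 4 2)`).
* D4 `IsProxyResolvable T P` — the tree's `IsNeckSurgeryResolvable` with its leaves replaced by
  `P ≅ S⁴` and `P ≅ S`, `S` the domain of a compact smooth blow-up model of `T`.
* small PROVED API: `not_isTameModel_empty` (= the registered anchor stub `stub_notIsTameModelEmpty` through
  which this vocabulary file lands `--supports stmt-SmoothPoincare4-7631`), `isBlowUpModel_empty`,
  `not_isTamePoint_zero` (no time-`0` point of a track in `[0, ∞)` is tame: the reason `IsTame` asks `t₀ > 0`).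

References: the line card `Cruxes/CylinderRungTwo/Lines/proxy-models-below-bubble-sheet.md`; B. White,
J. Amer. Math. Soc. 13 (2000) §2 and O. Hershkovits, B. White, Comm. Pure Appl. Math. 73 (2020), App.
Def. 19 (weak set flows, level set flow); T. Ilmanen, *Elliptic regularization and partial regularity for
motion by mean curvature*, Mem. AMS 520 (1994) (tangent flows); O. Chodosh, C. Mantoulidis, F. Schulze,
arXiv:2309.03856 (generic / non-generic singularities); R. S. Hamilton, Comm. Anal. Geom. 5 (1997) §1.1
(neck surgery).
-/

noncomputable section

-- the prescribed namespace repeats `SmoothPoincare4`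
set_option linter.dupNamespace false

open scoped BigOperators Manifold ContDiff ENNReal Topology
open Set Filter MeasureTheory
open Literature.Geometry.Riemannian Literature.Geometry.Lorentzian Literature.Topology.FourManifolds

namespace Summit.SmoothPoincare4.SmoothPoincare4.Cruxes.CylinderRungTwo.ProxyModelsBelowBubbleSheet

local notation "E5" => EuclideanSpace ℝ (Fin 5)
local notation "E6" => EuclideanSpace ℝ (Fin 6)

attribute [local instance] Literature.Topology.FourManifolds.fact_finrank_euclideanSpace_succ

/-! ### The arena -/

/-- The round cylinder `N = S⁴ × ℝ ⊂ ℝ⁶`, spelled exactly as in the route items. [folklore] -/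
def cylN : Set E6 := {z | ∑ i : Fin 5, z (Fin.castSucc i) ^ 2 = 1}

/-- `A ⊆ ℝ⁶` separates the two ends of `N` — the typed `JoinedIn` predicate of the route items, verbatim
(so that the crux hypothesis IS `SeparatesEnds (Set.range ι)` by `rfl`). [folklore] -/
def SeparatesEnds (A : Set E6) : Prop :=
  ∃ R : ℝ, ∀ a b : EuclideanSpace ℝ (Fin 6), ∑ i : Fin 5, a (Fin.castSucc i) ^ 2 = 1 →
    ∑ i : Fin 5, b (Fin.castSucc i) ^ 2 = 1 → a 5 ≤ -R → R ≤ b 5 →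
      ¬ JoinedIn ({z : EuclideanSpace ℝ (Fin 6) | ∑ i : Fin 5, z (Fin.castSucc i) ^ 2 = 1} \ A) a b

/-! ### D1. Presentations of `N` and the track of the level set flow -/

section Presentation

variable {Ncar : Type} [TopologicalSpace Ncar] [ChartedSpace (EuclideanSpace ℝ (Fin 5)) Ncar]
  [IsManifold (𝓡 5) ∞ Ncar]

/-- **Presentation of the round cylinder.** `(Ncar, gN, emb)` presents `N = S⁴ × ℝ` as an abstract
Riemannian 5-manifold: `emb : Ncar → ℝ⁶` is a `C^∞` embedding with range exactly `cylN`, and the tree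
metric `gN` is the pull-back of the Euclidean inner product, `gN(v, v) = ‖d emb (v)‖²` (polarisation gives
the bilinear identity). Any two presentations are isometric. [folklore] -/
def IsCylinderPresentation
    (gN : PseudoRiemannianMetric (𝓡 5) ∞ (EuclideanSpace ℝ (Fin 5)) (TangentSpace (𝓡 5) : Ncar → Type _))
    (emb : Ncar → E6) : Prop :=
  Manifold.IsSmoothEmbedding (𝓡 5) (𝓡 6) ∞ emb ∧ Set.range emb = cylN ∧
    ∀ (x : Ncar) (v : TangentSpace (𝓡 5) x),
      gN.val x v v = ‖(@id (EuclideanSpace ℝ (Fin 6)) (mfderiv (𝓡 5) (𝓡 6) emb x v))‖ ^ 2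

/-- **The spacetime track, downstairs in `ℝ⁶ × ℝ`, of the level set flow in `N` of `K₀ ⊆ Ncar`**:
`{(emb x, t) | x ∈ F_t(K₀)}`, `F_t = Literature.Geometry.Riemannian.levelSetFlow gN K₀ t` (White's biggest
weak set flow, empty for `t < 0`). [folklore] -/
def flowTrack
    (gN : PseudoRiemannianMetric (𝓡 5) ∞ (EuclideanSpace ℝ (Fin 5)) (TangentSpace (𝓡 5) : Ncar → Type _))
    [gN.HasLeviCivita] (emb : Ncar → E6) (K₀ : Set Ncar) : Set (E6 × ℝ) :=
  {q | ∃ x : Ncar, x ∈ levelSetFlow gN K₀ q.2 ∧ emb x = q.1}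

end Presentation

/-! ### D2. Set-level blow-ups -/

/-- Parabolic dilation of spacetime about `(x₀, t₀)` by the factor `lam`:
`(z, t) ↦ (lam • (z - x₀), lam² (t - t₀))`. [folklore] -/
def dilate (x₀ : E6) (t₀ lam : ℝ) (q : E6 × ℝ) : E6 × ℝ :=
  (lam • (q.1 - x₀), lam ^ 2 * (q.2 - t₀))

/-- The self-shrinking (backward) track `{(√(-t) · y, t) | y ∈ Mdl, t < 0}` of a set `Mdl ⊆ ℝ⁶`. [folklore] -/
def shrinkerTrack (Mdl : Set E6) : Set (E6 × ℝ) :=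
  {q | q.2 < 0 ∧ ∃ y ∈ Mdl, q.1 = Real.sqrt (-q.2) • y}

/-- The parabolic window `B̄_R(0) × [-R, -1/R]` (compact, strictly before the blow-up time; empty for
`R < 1`). [folklore] -/
def window (R : ℝ) : Set (E6 × ℝ) :=
  Metric.closedBall (0 : E6) R ×ˢ Set.Icc (-R) (-R⁻¹)

/-- **`Mdl` is a (set-level, backward) blow-up model of the track `T` at `(x₀, t₀)`**: `Mdl` is closed and
along some sequence of scales `Λ k → ∞` the dilated tracks converge to `shrinkerTrack Mdl` in the local
Hausdorff sense — on every window each lies in the `ε`-thickening of the other, eventually. For the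
support of a unit-regular integral Brakke flow these are the supports of its tangent flows at `(x₀, t₀)`
restricted to negative times; multiplicities are forgotten. [folklore] -/
def IsBlowUpModel (T : Set (E6 × ℝ)) (x₀ : E6) (t₀ : ℝ) (Mdl : Set E6) : Prop :=
  IsClosed Mdl ∧ ∃ Λ : ℕ → ℝ, Tendsto Λ atTop atTop ∧
    ∀ R ε : ℝ, 0 < R → 0 < ε → ∀ᶠ k in atTop,
      dilate x₀ t₀ (Λ k) '' T ∩ window R ⊆ Metric.thickening ε (shrinkerTrack Mdl) ∧
        shrinkerTrack Mdl ∩ window R ⊆ Metric.thickening ε (dilate x₀ t₀ (Λ k) '' T)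

/-! ### D3. Tame models, tame points, thin tracks -/

/-- **Tame models at `x₀ ∈ N`.** `Mdl ⊆ T_{x₀}N` is one of: a hyperplane through `0`; the round shrinking
neck `S³(√6) × ℝ` (`shrinkingCylinder 4 3`); or the image of a `C^∞` embedding `j : S → ℝ⁵` of a closed
connected smooth 4-manifold `S` — each placed in `T_{x₀}N ⊂ ℝ⁶` by a linear isometry `A : ℝ⁵ → ℝ⁶` with
range orthogonal to the normal `(x₀', 0)` of `N` at `x₀`. [folklore] -/
def IsTameModel (x₀ : E6) (Mdl : Set E6) : Prop :=
  ∃ A : E5 →ₗᵢ[ℝ] E6, (∀ v : E5, ∑ i : Fin 5, (A v) (Fin.castSucc i) * x₀ (Fin.castSucc i) = 0) ∧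
    (Mdl = (⇑A) '' {y : E5 | y 0 = 0} ∨ Mdl = (⇑A) '' shrinkingCylinder 4 3 ∨
      ∃ (S : Type) (_ : TopologicalSpace S) (_ : T2Space S) (_ : SecondCountableTopology S)
        (_ : CompactSpace S) (_ : ConnectedSpace S) (_ : ChartedSpace (EuclideanSpace ℝ (Fin 4)) S)
        (_ : IsManifold (𝓡 4) ∞ S) (j : S → E5),
        Manifold.IsSmoothEmbedding (𝓡 4) (𝓡 5) ∞ j ∧ Mdl = (⇑A) '' Set.range j)

/-- `(x₀, t₀)` is a **tame point** of the track `T`: every blow-up model there is tame. [folklore] -/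
def IsTamePoint (T : Set (E6 × ℝ)) (x₀ : E6) (t₀ : ℝ) : Prop :=
  ∀ Mdl : Set E6, IsBlowUpModel T x₀ t₀ Mdl → IsTameModel x₀ Mdl

/-- The track `T` is **tame**: every point of `T` at positive time is tame. [folklore] -/
def IsTame (T : Set (E6 × ℝ)) : Prop :=
  ∀ (x₀ : E6) (t₀ : ℝ), 0 < t₀ → (x₀, t₀) ∈ T → IsTamePoint T x₀ t₀

/-- The track `T` is **thin** (the level set flow does not fatten): every point of `T` is a limit of
points of `N × ℝ` off `T`. [folklore] -/
def HasThinTrack (T : Set (E6 × ℝ)) : Prop :=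
  ∀ q ∈ T, q ∈ closure ((cylN ×ˢ (Set.univ : Set ℝ)) \ T)

/-- **Hamilton's bound in CMS currency, for the track `T`**: every compact smooth blow-up model
`A''(range j)` of `T` at a positive time has Gaussian entropy (tree `gaussianEntropy 4`) strictly below
that of the bubble-sheet cylinder `S²(2) × ℝ² = shrinkingCylinder 4 2`. [folklore] -/
def ModelEntropyBound (T : Set (E6 × ℝ)) : Prop :=
  ∀ (x₀ : E6) (t₀ : ℝ), 0 < t₀ → ∀ (A : E5 →ₗᵢ[ℝ] E6),
    (∀ v : E5, ∑ i : Fin 5, (A v) (Fin.castSucc i) * x₀ (Fin.castSucc i) = 0) →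
    ∀ (S : Type) [TopologicalSpace S] [T2Space S] [SecondCountableTopology S] [CompactSpace S]
      [ConnectedSpace S] [ChartedSpace (EuclideanSpace ℝ (Fin 4)) S] [IsManifold (𝓡 4) ∞ S]
      (j : S → E5), Manifold.IsSmoothEmbedding (𝓡 4) (𝓡 5) ∞ j →
      IsBlowUpModel T x₀ t₀ ((⇑A) '' Set.range j) →
      gaussianEntropy 4 (Set.range j) < gaussianEntropy 4 (shrinkingCylinder 4 2)

/-! ### D4. Resolvability with model leaves -/

/-- **Resolvability by separating neck surgeries into spheres and compact smooth blow-up models of `T`**: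
the tree's `Literature.Geometry.Riemannian.IsNeckSurgeryResolvable` with its leaves replaced by (`sphere`)
`P ≅ S⁴` and (`model`) `P ≅ S`, `j : S → ℝ⁵` embedding the closed connected 4-manifold `S` as a compact
smooth blow-up model `A''(range j)` of `T` at some `(x₀, t₀)`, `t₀ > 0`; (`of_diffeomorph`) invariance;
(`surgery`) along a neck `ψ : S³ × ℝ ↪ P` whose middle sphere separates `P` into the sides `D₁`, `D₂`
(`NeckCapData`), from resolvability of the two capped sides. [folklore] -/
inductive IsProxyResolvable (T : Set (E6 × ℝ)) :
    ∀ (P : Type) [TopologicalSpace P] [ChartedSpace (EuclideanSpace ℝ (Fin 4)) P], Prop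
  /-- A piece diffeomorphic to `S⁴` is resolved. -/
  | sphere {P : Type} [TopologicalSpace P] [ChartedSpace (EuclideanSpace ℝ (Fin 4)) P]
      (e : P ≃ₘ⟮𝓡 4, 𝓡 4⟯ (Metric.sphere (0 : EuclideanSpace ℝ (Fin 5)) 1)) : IsProxyResolvable T P
  /-- A piece diffeomorphic to the domain of a compact smooth blow-up model of `T` is resolved. -/
  | model {P : Type} [TopologicalSpace P] [ChartedSpace (EuclideanSpace ℝ (Fin 4)) P]
      (x₀ : E6) (t₀ : ℝ) (ht₀ : 0 < t₀) (A : E5 →ₗᵢ[ℝ] E6)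
      (hA : ∀ v : E5, ∑ i : Fin 5, (A v) (Fin.castSucc i) * x₀ (Fin.castSucc i) = 0)
      (S : Type) [TopologicalSpace S] [T2Space S] [SecondCountableTopology S] [CompactSpace S]
      [ConnectedSpace S] [ChartedSpace (EuclideanSpace ℝ (Fin 4)) S] [IsManifold (𝓡 4) ∞ S]
      (j : S → E5) (hj : Manifold.IsSmoothEmbedding (𝓡 4) (𝓡 5) ∞ j)
      (hmodel : IsBlowUpModel T x₀ t₀ ((⇑A) '' Set.range j))
      (e : P ≃ₘ⟮𝓡 4, 𝓡 4⟯ S) : IsProxyResolvable T P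
  /-- Invariance under diffeomorphism onto a `C^∞` manifold. -/
  | of_diffeomorph {P P' : Type} [TopologicalSpace P] [ChartedSpace (EuclideanSpace ℝ (Fin 4)) P]
      [TopologicalSpace P'] [ChartedSpace (EuclideanSpace ℝ (Fin 4)) P'] [IsManifold (𝓡 4) ∞ P']
      (h : IsProxyResolvable T P) (e : P ≃ₘ⟮𝓡 4, 𝓡 4⟯ P') : IsProxyResolvable T P'
  /-- Surgery along a separating neck: if both capped sides are resolved, so is `P`. -/
  | surgery {P : Type} [TopologicalSpace P] [T2Space P] [ChartedSpace (EuclideanSpace ℝ (Fin 4)) P]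
      [IsManifold (𝓡 4) ∞ P] {ψ : (Metric.sphere (0 : EuclideanSpace ℝ (Fin 4)) 1) × ℝ → P}
      (D₁ : NeckCapData 3 ψ)
      (D₂ : NeckCapData 3 (fun q : (Metric.sphere (0 : EuclideanSpace ℝ (Fin 4)) 1) × ℝ => ψ (q.1, -q.2)))
      (hdisj : Disjoint (D₁.side : Set P) D₂.side)
      (hcover : ∀ p : P, p ∉ D₁.side → p ∉ D₂.side →
        ∃ θ : Metric.sphere (0 : EuclideanSpace ℝ (Fin 4)) 1, ψ (θ, 0) = p)
      (h₁ : IsProxyResolvable T D₁.Capped) (h₂ : IsProxyResolvable T D₂.Capped) :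
      IsProxyResolvable T P

/-! ### Elementary API (proved): the empty model and time-zero points

Sanity lemmas on D2–D3 (proved by the second lead's stub-worker for `stub_tameIsOpen`, file
`Theorems/CylinderEntropyCylinderRungTwoProxyModelsTameThin.lean` carries the rest): the empty set is never a tame
model, a point with an empty backward neighbourhood has `∅` as a blow-up model, hence NO point `(x₀, 0)` of a
track living in `[0, ∞)` (every `flowTrack`) is tame — which is why `IsTame` asks for `t₀ > 0` and why the `δ` of
`TameIsOpen` is `≤ t₀`. -/

/-- The empty set is not a tame model (the hyperplane and the neck are nonempty, and a CONNECTED model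
manifold `S` is nonempty). [folklore] -/
theorem not_isTameModel_empty (x₀ : E6) : ¬ IsTameModel x₀ ∅ := by
  rintro ⟨A, -, h | h | ⟨S, _, _, _, _, _, _, _, j, -, h⟩⟩
  · have h0 : A 0 ∈ (⇑A) '' {y : E5 | y 0 = 0} := ⟨0, by simp, rfl⟩
    rw [← h] at h0
    exact h0
  · have h1 : EuclideanSpace.single (0 : Fin 5) (Real.sqrt 6) ∈ shrinkingCylinder 4 3 := by
      rw [mem_shrinkingCylinder, Fin.sum_univ_five]
      norm_num [Real.sq_sqrt, Fin.ext_iff]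
    have h0 : A (EuclideanSpace.single (0 : Fin 5) (Real.sqrt 6)) ∈ (⇑A) '' shrinkingCylinder 4 3 :=
      ⟨_, h1, rfl⟩
    rw [← h] at h0
    exact h0
  · obtain ⟨p⟩ := (inferInstance : Nonempty S)
    have h0 : A (j p) ∈ (⇑A) '' Set.range j := ⟨j p, Set.mem_range_self p, rfl⟩
    rw [← h] at h0
    exact h0

/-- If `T` has NO points in a backward neighbourhood `B(x₀, r) × (t₀ - r, t₀)` of `(x₀, t₀)`, then `∅` is a
blow-up model of `T` at `(x₀, t₀)` (every window is eventually empty). [folklore] -/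
theorem isBlowUpModel_empty {T : Set (E6 × ℝ)} {x₀ : E6} {t₀ : ℝ}
    (h : ∃ r > 0, ∀ q ∈ T, dist q.1 x₀ < r → q.2 ∈ Set.Ioo (t₀ - r) t₀ → False) :
    IsBlowUpModel T x₀ t₀ ∅ := by
  obtain ⟨r, hr, hvac⟩ := h
  have hΛ : Tendsto (fun k : ℕ => (k : ℝ) + 1) atTop atTop :=
    tendsto_atTop_add_const_right _ _ tendsto_natCast_atTop_atTop
  refine ⟨isClosed_empty, fun k => (k : ℝ) + 1, hΛ, ?_⟩
  intro R ε hR _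
  filter_upwards [hΛ.eventually_gt_atTop (R / r)] with k hk
  set L : ℝ := (k : ℝ) + 1 with hL
  have hL0 : 0 < L := by positivity
  have hRL : R < L * r := by
    rw [div_lt_iff₀ hr] at hk
    linarith
  have hempty : shrinkerTrack (∅ : Set E6) = ∅ := by
    ext q
    simp [shrinkerTrack]
  refine ⟨?_, by rw [hempty, Set.empty_inter]; exact Set.empty_subset _⟩
  rintro q ⟨⟨p, hpT, rfl⟩, hwin⟩
  exfalso
  simp only [dilate, window, Set.mem_prod, Metric.mem_closedBall, dist_zero_right, Set.mem_Icc] at hwin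
  refine hvac p hpT ?_ ⟨?_, ?_⟩
  · rw [dist_eq_norm]
    rw [norm_smul, Real.norm_eq_abs, abs_of_pos hL0] at hwin
    nlinarith [hwin.1]
  · have h1 : L * r ≤ L ^ 2 * r := by nlinarith
    nlinarith [hwin.2.1]
  · have hRi : (0 : ℝ) < R⁻¹ := inv_pos.2 hR
    nlinarith [hwin.2.2]

/-- Hence a point of `T` with an empty backward neighbourhood is NOT tame; in particular, for a track living in
`[0, ∞)` (as every `flowTrack` does), no point `(x₀, 0)` is tame. [folklore] -/
theorem not_isTamePoint_zero {T : Set (E6 × ℝ)} (hT : ∀ q ∈ T, (0 : ℝ) ≤ q.2) (x₀ : E6) :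
    ¬ IsTamePoint T x₀ 0 := fun hp =>
  not_isTameModel_empty x₀ (hp ∅ (isBlowUpModel_empty ⟨1, one_pos, fun q hq _ ht => by
    have := hT q hq
    rw [Set.mem_Ioo] at ht
    linarith [ht.2]⟩))

/-- **Registered stub `stub_notIsTameModelEmpty`** (vocabulary anchor of this `Defs` file, through which it lands
`--supports stmt-SmoothPoincare4-7631`): the empty set is never a tame model. [folklore] -/
theorem stub_notIsTameModelEmpty : ∀ x₀ : EuclideanSpace ℝ (Fin 6), ¬ IsTameModel x₀ ∅ :=
  not_isTameModel_empty

end Summit.SmoothPoincare4.SmoothPoincare4.Cruxes.CylinderRungTwo.ProxyModelsBelowBubbleSheet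

end
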